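import Literature.Analysis.FunctionSpaces.WeakCompactnessL1
import Literature.Analysis.FunctionSpaces.DiagonalWeakLimits
import Mathlib.MeasureTheory.Function.L2Space
import HarnessLib

/-!
# The Dunford–Pettis theorem, compactness direction: proof

Analysis/FunctionSpaces proof file for `Literature.Analysis.FunctionSpaces.WeakCompactnessL1`:
the named fact `Literature.Analysis.FunctionSpaces.dunfordPettis_exists_subseq` (Fonseca–Leoni 2007, Thm 2.54, sufficiency;
Dunford–Schwartz I, Cor. IV.8.11) is **discharged**:

* `Literature.dunfordPettis_exists_subseq_holds : dunfordPettis_exists_subseq` — a uniformly integrable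
  (`MeasureTheory.UniformIntegrable f 1 μ`: a.e.-strongly measurable, equi-integrable, bounded in
  `L¹`) and uniformly tight (`MeasureTheory.UnifTight f 1 μ`) sequence of real functions has a
  subsequence converging weakly in `L¹` (`Literature.Analysis.FunctionSpaces.TendstoWeaklyL1`: against every essentially bounded
  multiplier) to an integrable limit. (The `σ`-finiteness assumed in the fact is not used.)

Proof (the `L²` route, e.g. Fonseca–Leoni 2007 proof of Thm 2.54, Step 2): on the `k`-th tight set
`S_k` (finite measure, tails `≤ (k+1)⁻¹` in `L¹` uniformly in `n`) truncate at height `k`,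
`g_n^k = 1_{S_k} max(-k, min(k, f_n))`; these are bounded in the Hilbert space `L²(μ|_{S_k})`, so by
`Literature.Analysis.FunctionSpaces.exists_strictMono_forall_tendsto_inner` (diagonal extraction over the countably many bounded
pairings, `Literature.Analysis.FunctionSpaces.exists_strictMono_forall_tendsto_real`, and weak limits from pairings on a spanning
set, `Literature.Analysis.FunctionSpaces.exists_mem_tendsto_inner_of_subset_closure_span`, both from
`Literature.Analysis.FunctionSpaces.DiagonalWeakLimits`) one subsequence `ψ` makes every
`g_{ψ n}^k` converge weakly in `L²(μ|_{S_k})`, hence weakly in `L¹(μ)` against bounded multipliers,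
to some `u_k`. Equi-integrability (`MeasureTheory.UniformIntegrable.spec'`) and tightness give
`sup_n ‖f_n - g_n^k‖₁ → 0`; by the weak lower semicontinuity of the `L¹` norm
(`Literature.Analysis.FunctionSpaces.TendstoWeaklyL1.lintegral_enorm_le_of_eventually_le`) `(u_k)` is Cauchy in `L¹`, with limit
`G`, and an `ε/3` argument gives `f_{ψ n} ⇀ G`.

## Mathlib search

Mathlib (this pin) has `UniformIntegrable`, `UnifTight`, the Vitali convergence theorem and the
Hilbert space `MeasureTheory.L2`, but no Dunford–Pettis theorem and no weak sequential compactness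
of bounded sets in `L¹` or `L²` (searched `Dunford`, `weakly`/`WeakSpace` + `compact` in
`MeasureTheory/Function`, `Analysis/InnerProductSpace`).

## References

* I. Fonseca, G. Leoni, *Modern Methods in the Calculus of Variations: `L^p` Spaces*, Springer
  (2007), Thm 2.54 (Dunford–Pettis), p. 175.
* N. Dunford, J. T. Schwartz, *Linear Operators I*, Interscience (1958), Cor. IV.8.11.
-/

noncomputable section

open MeasureTheory Set Filter Topology
open scoped ENNReal NNReal InnerProductSpace

namespace Literature.Analysis.FunctionSpaces

/-! ## Weak sequential compactness of bounded sequences in Hilbert spaces -/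

/-- **Bounded sequences in Hilbert spaces have weakly convergent subsequences — countably many
spaces at once.** If `v k : ℕ → H k` is bounded by `M k` in the real Hilbert space `H k` for each
`k` in a countable index set, one strictly increasing `φ` makes every `v k ∘ φ` converge weakly to
some `w k` with `‖w k‖ ≤ M k` (diagonal extraction on the countably many bounded pairings
`⟪v k n, v k i⟫`, then `exists_mem_tendsto_inner_of_subset_closure_span` in the closed span of
each sequence). [folklore] -/
theorem exists_strictMono_forall_tendsto_inner {ι : Type*} [Countable ι] {H : ι → Type*}
    [∀ k, NormedAddCommGroup (H k)] [∀ k, InnerProductSpace ℝ (H k)] [∀ k, CompleteSpace (H k)]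
    (v : ∀ k, ℕ → H k) (M : ι → ℝ) (hM : ∀ k n, ‖v k n‖ ≤ M k) :
    ∃ φ : ℕ → ℕ, StrictMono φ ∧ ∀ k, ∃ w : H k, ‖w‖ ≤ M k ∧
      ∀ z, Tendsto (fun n => ⟪v k (φ n), z⟫_ℝ) atTop (𝓝 ⟪w, z⟫_ℝ) := by
  -- diagonal extraction on the pairings
  set x : ℕ → (Σ _ : ι, ℕ) → ℝ := fun n p => ⟪v p.1 n, v p.1 p.2⟫_ℝ with hx
  have hb : ∀ p : Σ _ : ι, ℕ, ∃ R : ℝ, ∀ n, |x n p| ≤ R := fun p =>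
    ⟨M p.1 * M p.1, fun n => (abs_real_inner_le_norm _ _).trans
      (mul_le_mul (hM _ _) (hM _ _) (norm_nonneg _) ((norm_nonneg _).trans (hM p.1 n)))⟩
  obtain ⟨φ, hφ, hconv⟩ := exists_strictMono_forall_tendsto_real x hb
  refine ⟨φ, hφ, fun k => ?_⟩
  set K : Submodule ℝ (H k) := (Submodule.span ℝ (range (v k))).topologicalClosure with hK
  have hKc : IsClosed (K : Set (H k)) := Submodule.isClosed_topologicalClosure _
  have hD : (K : Set (H k)) ⊆ closure (Submodule.span ℝ (range (v k)) : Set (H k)) := by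
    rw [hK, Submodule.topologicalClosure_coe]
  have hv : ∀ n, v k (φ n) ∈ K := fun n =>
    Submodule.le_topologicalClosure _ (Submodule.subset_span (mem_range_self _))
  have hc : ∀ d ∈ range (v k), ∃ l, Tendsto (fun n => ⟪v k (φ n), d⟫_ℝ) atTop (𝓝 l) := by
    rintro d ⟨i, rfl⟩
    exact hconv ⟨k, i⟩
  obtain ⟨w, -, hwM, hw⟩ := exists_mem_tendsto_inner_of_subset_closure_span K hKc hD hv
    (fun n => hM k (φ n)) hc
  exact ⟨w, hwM, hw⟩

/-! ## Elementary tools -/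

section Tools

variable {α : Type*} [MeasurableSpace α] {μ : Measure α}

/-- The two-sided truncation `max (-k) (min k y)` is bounded by `k`. [folklore] -/
theorem abs_max_neg_min_le {k : ℝ} (hk : 0 ≤ k) (y : ℝ) : |max (-k) (min k y)| ≤ k := by
  rw [abs_le]
  exact ⟨le_max_left _ _, max_le (by linarith) (min_le_left _ _)⟩

/-- The two-sided truncation at height `k` does not move `y` when `|y| ≤ k`. [folklore] -/
theorem max_neg_min_eq_self {k y : ℝ} (h : |y| ≤ k) : max (-k) (min k y) = y := by
  rw [abs_le] at h
  rw [min_eq_right h.2, max_eq_right h.1]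

/-- The truncation error is at most `|y|`. [folklore] -/
theorem abs_sub_max_neg_min_le {k : ℝ} (hk : 0 ≤ k) (y : ℝ) : |y - max (-k) (min k y)| ≤ |y| := by
  rcases le_total y k with h | h
  · rw [min_eq_right h]
    rcases le_total (-k) y with h' | h'
    · rw [max_eq_right h']; simp
    · rw [max_eq_left h', abs_le]
      constructor <;> [nlinarith [abs_nonneg y, abs_le.1 (le_refl |y|), neg_abs_le y]; nlinarith [le_abs_self y, neg_abs_le y]]
  · rw [min_eq_left h, max_eq_right (by linarith : -k ≤ k), abs_le]
    constructor <;> nlinarith [le_abs_self y, neg_abs_le y]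

omit [MeasurableSpace α] in
/-- The triangle inequality for `‖· - ·‖ₑ` on `ℝ`. [folklore] -/
theorem enorm_sub_le_add (a b c : ℝ) : ‖a - c‖ₑ ≤ ‖a - b‖ₑ + ‖b - c‖ₑ := by
  rw [← edist_eq_enorm_sub, ← edist_eq_enorm_sub, ← edist_eq_enorm_sub]
  exact edist_triangle a b c

/-- `|∫ u φ| ≤ C · ∫ |u|` for a multiplier bounded by `C` a.e., with `∫ |u|` given as a bound on
the lower integral. [folklore] -/
theorem abs_integral_mul_le_of_lintegral_le {u φ : α → ℝ} (hu : AEStronglyMeasurable u μ)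
    {C : ℝ} (hC : 0 ≤ C) (hφ : ∀ᵐ x ∂μ, |φ x| ≤ C) {a : ℝ≥0∞} (ha : a ≠ ∞)
    (hle : ∫⁻ x, ‖u x‖ₑ ∂μ ≤ a) :
    |∫ x, u x * φ x ∂μ| ≤ C * a.toReal := by
  have hui : Integrable u μ := ⟨hu, hle.trans_lt ha.lt_top⟩
  calc |∫ x, u x * φ x ∂μ| ≤ ∫ x, |u x * φ x| ∂μ := abs_integral_le_integral_abs
    _ ≤ ∫ x, C * |u x| ∂μ := by
        refine integral_mono_of_nonneg (ae_of_all _ fun x => abs_nonneg _)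
          (hui.abs.const_mul C) ?_
        filter_upwards [hφ] with x hx
        rw [abs_mul, mul_comm C]
        exact mul_le_mul_of_nonneg_left hx (abs_nonneg _)
    _ = C * (∫⁻ x, ‖u x‖ₑ ∂μ).toReal := by
        rw [integral_const_mul, ← integral_norm_eq_lintegral_enorm hu]
        rfl
    _ ≤ C * a.toReal := mul_le_mul_of_nonneg_left (ENNReal.toReal_mono ha hle) hC

/-- **Weak lower semicontinuity of the `L¹` norm**, eventual form: if `F n ⇀ G` weakly in `L¹`
and eventually `∫ |F n| ≤ a`, then `∫ |G| ≤ a` (test against the sign of `G`). [folklore] -/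
theorem TendstoWeaklyL1.lintegral_enorm_le_of_eventually_le {F : ℕ → α → ℝ} {G : α → ℝ}
    (h : TendstoWeaklyL1 F G μ) (hFm : ∀ n, AEStronglyMeasurable (F n) μ) (hG : Integrable G μ)
    {a : ℝ≥0∞} (hF : ∀ᶠ n in atTop, ∫⁻ x, ‖F n x‖ₑ ∂μ ≤ a) :
    ∫⁻ x, ‖G x‖ₑ ∂μ ≤ a := by
  rcases eq_or_ne a ∞ with rfl | ha
  · exact le_top
  -- the sign of a measurable representative of `G`
  set G' : α → ℝ := hG.1.mk G with hG'
  have hG'm : Measurable G' := hG.1.stronglyMeasurable_mk.measurable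
  have hGG' : G =ᵐ[μ] G' := hG.1.ae_eq_mk
  set φ : α → ℝ := fun x => if 0 ≤ G' x then 1 else -1 with hφ
  have hφm : Measurable φ := Measurable.ite (measurableSet_le measurable_const hG'm)
    measurable_const measurable_const
  have hφb : ∀ x, |φ x| ≤ 1 := fun x => by
    simp only [hφ]; split_ifs <;> simp
  have hlim := h φ 1 hφm.aestronglyMeasurable (ae_of_all _ hφb)
  -- `∫ G φ = ∫ |G|`
  have h1 : ∫ x, G x * φ x ∂μ = (∫⁻ x, ‖G x‖ₑ ∂μ).toReal := by
    rw [← integral_norm_eq_lintegral_enorm hG.1]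
    refine integral_congr_ae ?_
    filter_upwards [hGG'] with x hx
    simp only [hφ, Real.norm_eq_abs]
    rw [hx]
    split_ifs with h0
    · rw [mul_one, abs_of_nonneg h0]
    · rw [mul_neg, mul_one, abs_of_neg (not_le.1 h0)]
  -- `∫ F n φ ≤ a`
  have h2 : ∀ᶠ n in atTop, ∫ x, F n x * φ x ∂μ ≤ a.toReal := by
    filter_upwards [hF] with n hn
    refine (le_abs_self _).trans ?_
    have := abs_integral_mul_le_of_lintegral_le (hFm n) zero_le_one (ae_of_all _ hφb) ha hn
    simpa using this
  have h3 : (∫⁻ x, ‖G x‖ₑ ∂μ).toReal ≤ a.toReal := by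
    rw [← h1]
    exact le_of_tendsto hlim h2
  have hfin : ∫⁻ x, ‖G x‖ₑ ∂μ ≠ ∞ := hG.2.ne
  exact (ENNReal.toReal_le_toReal hfin ha).1 h3

end Tools


/-! ## The Dunford–Pettis theorem, compactness direction -/

section DunfordPettis

variable {α : Type*} [MeasurableSpace α] {μ : Measure α}

/-- **Dunford–Pettis, strongly measurable representatives.** A uniformly integrable and uniformly
tight sequence of strongly measurable real functions has a subsequence converging weakly in `L¹`
(against every essentially bounded multiplier) to an integrable limit. Proof: truncate at height
`k` on the `k`-th tight set `S_k` (finite measure), extract by weak compactness in the Hilbert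
spaces `L²(μ|_{S_k})` one subsequence for all `k` (`exists_strictMono_forall_tendsto_inner`), and
pass `k → ∞` using `sup_n ‖f_n - g_n^k‖₁ → 0` (equi-integrability and tightness), the weak lower
semicontinuity of the `L¹` norm and the completeness of `L¹`. [cite: FonsecaLeoni2007, Thm 2.54] -/
theorem exists_subseq_tendstoWeaklyL1_of_stronglyMeasurable {f : ℕ → α → ℝ}
    (hfm : ∀ n, StronglyMeasurable (f n)) (hUI : UniformIntegrable f 1 μ) (hUT : UnifTight f 1 μ) :
    ∃ ψ : ℕ → ℕ, StrictMono ψ ∧ ∃ g : α → ℝ, Integrable g μ ∧ TendstoWeaklyL1 (f ∘ ψ) g μ := by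
  have hmeas : ∀ n, Measurable (f n) := fun n => (hfm n).measurable
  have hint : ∀ n, Integrable (f n) μ := fun n => memLp_one_iff_integrable.1 (hUI.memLp n)
  -- Step 1: the tight sets `S k`
  have hS : ∀ k : ℕ, ∃ s : Set α, MeasurableSet s ∧ μ s < ∞ ∧
      ∀ n, eLpNorm (sᶜ.indicator (f n)) 1 μ ≤ ((k : ℝ≥0∞) + 1)⁻¹ := fun k =>
    hUT.exists_measurableSet_indicator (ENNReal.inv_ne_zero.2 (by finiteness))
  choose S hSm hSfin hSt using hS
  have hfinI : ∀ k, IsFiniteMeasure (μ.restrict (S k)) := fun k =>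
    isFiniteMeasure_restrict.2 (hSfin k).ne
  -- Step 2: the truncations `g n k = 1_{S k} T_k (f n)`
  set g : ℕ → ℕ → α → ℝ := fun n k => (S k).indicator fun x => max (-(k : ℝ)) (min (k : ℝ) (f n x)) with hg
  have hgm : ∀ n k, Measurable (g n k) := fun n k =>
    (measurable_const.max (measurable_const.min (hmeas n))).indicator (hSm k)
  have hTb : ∀ n (k : ℕ) x, ‖max (-(k : ℝ)) (min (k : ℝ) (f n x))‖ ≤ k := fun n k x => by
    rw [Real.norm_eq_abs]; exact abs_max_neg_min_le (Nat.cast_nonneg k) _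
  have hmemT : ∀ n (k : ℕ) (p : ℝ≥0∞), MemLp (fun x => max (-(k : ℝ)) (min (k : ℝ) (f n x))) p (μ.restrict (S k)) := by
    intro n k p
    haveI := hfinI k
    exact (memLp_top_of_bound (measurable_const.max (measurable_const.min (hmeas n))).aestronglyMeasurable
      (k : ℝ) (ae_of_all _ fun x => hTb n k x)).mono_exponent le_top
  have hgint : ∀ n k, Integrable (g n k) μ := fun n k =>
    (show IntegrableOn (fun x => max (-(k : ℝ)) (min (k : ℝ) (f n x))) (S k) μ from
      memLp_one_iff_integrable.1 (hmemT n k 1)).integrable_indicator (hSm k)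
  -- Step 3: the bounded sequences in the Hilbert spaces `L²(μ|S k)`
  set v : ∀ k : ℕ, ℕ → Lp ℝ 2 (μ.restrict (S k)) := fun k n => (hmemT n k 2).toLp _ with hv
  set Mk : ℕ → ℝ := fun k => ((μ (S k)) ^ (2 : ℝ)⁻¹ * ENNReal.ofReal k).toReal with hMk
  have hvM : ∀ k n, ‖v k n‖ ≤ Mk k := by
    intro k n
    simp only [hv, Lp.norm_toLp, hMk]
    have hle : eLpNorm (fun x => max (-(k : ℝ)) (min (k : ℝ) (f n x))) 2 (μ.restrict (S k)) ≤
        (μ (S k)) ^ (2 : ℝ)⁻¹ * ENNReal.ofReal k := by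
      have := eLpNorm_le_of_ae_bound (p := 2) (μ := μ.restrict (S k))
        (f := fun x => max (-(k : ℝ)) (min (k : ℝ) (f n x))) (C := k) (ae_of_all _ fun x => hTb n k x)
      rwa [Measure.restrict_apply_univ, ENNReal.toReal_ofNat] at this
    refine ENNReal.toReal_mono ?_ hle
    exact ENNReal.mul_ne_top (ENNReal.rpow_ne_top_of_nonneg (by positivity) (hSfin k).ne)
      ENNReal.ofReal_ne_top
  -- Step 4: one subsequence and weak `L²` limits for every `k`
  obtain ⟨ψ, hψ, hw⟩ := exists_strictMono_forall_tendsto_inner v Mk hvM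
  choose w _hwM hw using hw
  -- Step 5: `u k = 1_{S k} w k` and the weak `L¹` convergence of the truncations
  set u : ℕ → α → ℝ := fun k => (S k).indicator (w k : α → ℝ) with hu
  have hwint : ∀ k, Integrable (w k : α → ℝ) (μ.restrict (S k)) := fun k => by
    haveI := hfinI k; exact (Lp.memLp (w k)).integrable one_le_two
  have huint : ∀ k, Integrable (u k) μ := fun k =>
    (show IntegrableOn (w k : α → ℝ) (S k) μ from hwint k).integrable_indicator (hSm k)
  have hpair : ∀ k, TendstoWeaklyL1 (fun n => g (ψ n) k) (u k) μ := by
    intro k φ C hφm hφC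
    haveI := hfinI k
    have hφC' : ∀ᵐ x ∂(μ.restrict (S k)), ‖φ x‖ ≤ C :=
      ae_restrict_of_ae (hφC.mono fun x hx => by rwa [Real.norm_eq_abs])
    have hΦmem : MemLp φ 2 (μ.restrict (S k)) :=
      (memLp_top_of_bound hφm.restrict C hφC').mono_exponent le_top
    set Φ : Lp ℝ 2 (μ.restrict (S k)) := hΦmem.toLp φ with hΦ
    have h1 : ∀ n, ∫ x, g n k x * φ x ∂μ = ⟪v k n, Φ⟫_ℝ := by
      intro n
      rw [MeasureTheory.L2.inner_def]
      have : (fun x => g n k x * φ x) = (S k).indicator (fun x => max (-(k : ℝ)) (min (k : ℝ) (f n x)) * φ x) := by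
        funext x
        simp only [hg]
        by_cases hx : x ∈ S k
        · rw [indicator_of_mem hx, indicator_of_mem hx]
        · rw [indicator_of_notMem hx, indicator_of_notMem hx, zero_mul]
      rw [this, integral_indicator (hSm k)]
      refine integral_congr_ae ?_
      filter_upwards [(hmemT n k 2).coeFn_toLp, hΦmem.coeFn_toLp] with x hx hΦx
      rw [RCLike.inner_apply, conj_trivial, hΦx]
      simp only [hv] at hx ⊢
      rw [hx, mul_comm]
    have h2 : ∫ x, u k x * φ x ∂μ = ⟪w k, Φ⟫_ℝ := by
      rw [MeasureTheory.L2.inner_def]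
      have : (fun x => u k x * φ x) = (S k).indicator (fun x => (w k : α → ℝ) x * φ x) := by
        funext x
        simp only [hu]
        by_cases hx : x ∈ S k
        · rw [indicator_of_mem hx, indicator_of_mem hx]
        · rw [indicator_of_notMem hx, indicator_of_notMem hx, zero_mul]
      rw [this, integral_indicator (hSm k)]
      refine integral_congr_ae ?_
      filter_upwards [hΦmem.coeFn_toLp] with x hΦx
      rw [RCLike.inner_apply, conj_trivial, hΦx, mul_comm]
    have h3 := hw k Φ
    rw [← h2] at h3
    refine h3.congr fun n => ?_
    rw [← h1]
  -- Step 6: `sup_n ‖f n - g n k‖₁ → 0`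
  have happrox : ∀ ε : ℝ, 0 < ε → ∃ k₀ : ℕ, ∀ k, k₀ ≤ k → ∀ n,
      ∫⁻ x, ‖f n x - g n k x‖ₑ ∂μ ≤ ENNReal.ofReal ε := by
    intro ε hε
    obtain ⟨Cε, hCε⟩ := hUI.spec' one_ne_zero ENNReal.one_ne_top hfm (half_pos hε)
    obtain ⟨k₁, hk₁⟩ := exists_nat_ge ((Cε : ℝ) + 2 / ε)
    refine ⟨k₁, fun k hk n => ?_⟩
    have hk' : (k₁ : ℝ) ≤ k := by exact_mod_cast hk
    have h2ε : (0 : ℝ) < 2 / ε := by positivity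
    have hkC : (Cε : ℝ) ≤ k := by linarith
    have hkε : ((k : ℝ≥0∞) + 1)⁻¹ ≤ ENNReal.ofReal (ε / 2) := by
      have hpos : (0 : ℝ) < (k : ℝ) + 1 := by positivity
      have : ((k : ℝ≥0∞) + 1) = ENNReal.ofReal ((k : ℝ) + 1) := by
        rw [ENNReal.ofReal_add (by positivity) zero_le_one, ENNReal.ofReal_natCast,
          ENNReal.ofReal_one]
      rw [this, ← ENNReal.ofReal_inv_of_pos hpos]
      refine ENNReal.ofReal_le_ofReal ?_
      rw [inv_le_comm₀ hpos (by positivity), inv_div]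
      have hC0 : (0 : ℝ) ≤ Cε := Cε.coe_nonneg
      linarith
    have hpt : ∀ x, ‖f n x - g n k x‖ₑ ≤
        ‖(S k)ᶜ.indicator (f n) x‖ₑ + ‖{x | Cε ≤ ‖f n x‖₊}.indicator (f n) x‖ₑ := by
      intro x
      by_cases hx : x ∈ S k
      · have hg' : g n k x = max (-(k : ℝ)) (min (k : ℝ) (f n x)) := by simp only [hg]; rw [indicator_of_mem hx]
        rw [hg', indicator_of_notMem (show x ∉ (S k)ᶜ from fun h => h hx), enorm_zero, zero_add]
        by_cases hfx : |f n x| ≤ k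
        · rw [max_neg_min_eq_self hfx, sub_self, enorm_zero]
          exact zero_le
        · have hmem : x ∈ {x | Cε ≤ ‖f n x‖₊} := by
            rw [mem_setOf_eq, ← NNReal.coe_le_coe, coe_nnnorm, Real.norm_eq_abs]
            push Not at hfx
            linarith
          rw [indicator_of_mem hmem, Real.enorm_eq_ofReal_abs, Real.enorm_eq_ofReal_abs]
          exact ENNReal.ofReal_le_ofReal (abs_sub_max_neg_min_le (Nat.cast_nonneg k) _)
      · have hg' : g n k x = 0 := by simp only [hg]; rw [indicator_of_notMem hx]
        rw [hg', sub_zero, indicator_of_mem (mem_compl hx)]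
        exact le_self_add
    calc ∫⁻ x, ‖f n x - g n k x‖ₑ ∂μ
        ≤ ∫⁻ x, (‖(S k)ᶜ.indicator (f n) x‖ₑ + ‖{x | Cε ≤ ‖f n x‖₊}.indicator (f n) x‖ₑ) ∂μ :=
          lintegral_mono hpt
      _ = eLpNorm ((S k)ᶜ.indicator (f n)) 1 μ +
            eLpNorm ({x | Cε ≤ ‖f n x‖₊}.indicator (f n)) 1 μ := by
          rw [lintegral_add_left (((hmeas n).indicator (hSm k).compl).enorm),
            eLpNorm_one_eq_lintegral_enorm, eLpNorm_one_eq_lintegral_enorm]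
      _ ≤ ((k : ℝ≥0∞) + 1)⁻¹ + ENNReal.ofReal (ε / 2) := add_le_add (hSt k n) (hCε n)
      _ ≤ ENNReal.ofReal (ε / 2) + ENNReal.ofReal (ε / 2) := add_le_add hkε le_rfl
      _ = ENNReal.ofReal ε := by
          rw [← ENNReal.ofReal_add (by positivity) (by positivity), add_halves]
  -- Step 7: `(u k)` is Cauchy in `L¹`
  have huC : ∀ ε : ℝ, 0 < ε → ∃ k₀ : ℕ, ∀ k, k₀ ≤ k → ∀ l, k₀ ≤ l →
      ∫⁻ x, ‖u k x - u l x‖ₑ ∂μ ≤ ENNReal.ofReal ε + ENNReal.ofReal ε := by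
    intro ε hε
    obtain ⟨k₀, hk₀⟩ := happrox ε hε
    refine ⟨k₀, fun k hk l hl => ?_⟩
    have hwk : TendstoWeaklyL1 (fun n x => g (ψ n) k x - g (ψ n) l x) (fun x => u k x - u l x) μ := by
      intro φ C hφm hφC
      have hC' : ∀ᵐ x ∂μ, ‖φ x‖ ≤ C := hφC.mono fun x hx => by rwa [Real.norm_eq_abs]
      have h1 := (hpair k φ C hφm hφC).sub (hpair l φ C hφm hφC)
      have e1 : ∀ n, ∫ x, (g (ψ n) k x - g (ψ n) l x) * φ x ∂μ =
          ∫ x, g (ψ n) k x * φ x ∂μ - ∫ x, g (ψ n) l x * φ x ∂μ := fun n => by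
        rw [← integral_sub ((hgint _ k).mul_bdd hφm hC') ((hgint _ l).mul_bdd hφm hC')]
        exact integral_congr_ae (ae_of_all _ fun x => by ring)
      have e2 : ∫ x, (u k x - u l x) * φ x ∂μ = ∫ x, u k x * φ x ∂μ - ∫ x, u l x * φ x ∂μ := by
        rw [← integral_sub ((huint k).mul_bdd hφm hC') ((huint l).mul_bdd hφm hC')]
        exact integral_congr_ae (ae_of_all _ fun x => by ring)
      show Tendsto (fun n => ∫ x, (g (ψ n) k x - g (ψ n) l x) * φ x ∂μ) atTop
        (𝓝 (∫ x, (u k x - u l x) * φ x ∂μ))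
      simp_rw [e1, e2]
      exact h1
    refine hwk.lintegral_enorm_le_of_eventually_le
      (fun n => ((hgm _ k).sub (hgm _ l)).aestronglyMeasurable) ((huint k).sub (huint l))
      (Eventually.of_forall fun n => ?_)
    calc ∫⁻ x, ‖g (ψ n) k x - g (ψ n) l x‖ₑ ∂μ
        ≤ ∫⁻ x, (‖f (ψ n) x - g (ψ n) k x‖ₑ + ‖f (ψ n) x - g (ψ n) l x‖ₑ) ∂μ := by
          refine lintegral_mono fun x => ?_
          calc ‖g (ψ n) k x - g (ψ n) l x‖ₑ
              ≤ ‖g (ψ n) k x - f (ψ n) x‖ₑ + ‖f (ψ n) x - g (ψ n) l x‖ₑ := enorm_sub_le_add _ _ _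
            _ = ‖f (ψ n) x - g (ψ n) k x‖ₑ + ‖f (ψ n) x - g (ψ n) l x‖ₑ := by
                rw [← enorm_neg (g (ψ n) k x - f (ψ n) x), neg_sub]
      _ = ∫⁻ x, ‖f (ψ n) x - g (ψ n) k x‖ₑ ∂μ + ∫⁻ x, ‖f (ψ n) x - g (ψ n) l x‖ₑ ∂μ :=
          lintegral_add_left (((hmeas _).sub (hgm _ k)).enorm) _
      _ ≤ ENNReal.ofReal ε + ENNReal.ofReal ε := add_le_add (hk₀ k hk _) (hk₀ l hl _)
  -- Step 8: the `L¹` limit `G`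
  set U : ℕ → (α →₁[μ] ℝ) := fun k => (huint k).toL1 (u k) with hU
  have hUdist : ∀ k l, edist (U k) (U l) = ∫⁻ x, ‖u k x - u l x‖ₑ ∂μ := by
    intro k l
    simp only [hU, Integrable.edist_toL1_toL1]
    exact lintegral_congr fun x => edist_eq_enorm_sub _ _
  have hUc : CauchySeq U := by
    refine EMetric.cauchySeq_iff.2 fun ε hε => ?_
    rcases eq_or_ne ε ∞ with rfl | hεt
    · exact ⟨0, fun k _ l _ => (edist_ne_top _ _).lt_top⟩
    have hε' : 0 < ε.toReal / 3 := by
      have := ENNReal.toReal_pos hε.ne' hεt; positivity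
    obtain ⟨k₀, hk₀⟩ := huC (ε.toReal / 3) hε'
    refine ⟨k₀, fun k hk l hl => ?_⟩
    rw [hUdist]
    refine (hk₀ k hk l hl).trans_lt ?_
    rw [← ENNReal.ofReal_add hε'.le hε'.le]
    calc ENNReal.ofReal (ε.toReal / 3 + ε.toReal / 3) < ENNReal.ofReal ε.toReal := by
          refine (ENNReal.ofReal_lt_ofReal_iff (ENNReal.toReal_pos hε.ne' hεt)).2 ?_
          linarith [ENNReal.toReal_pos hε.ne' hεt]
      _ = ε := ENNReal.ofReal_toReal hεt
  obtain ⟨Ul, hUl⟩ := cauchySeq_tendsto_of_complete hUc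
  set G : α → ℝ := (Ul : α → ℝ) with hG
  have hGint : Integrable G μ := L1.integrable_coeFn Ul
  have hUG : Tendsto (fun k => ∫⁻ x, ‖u k x - G x‖ₑ ∂μ) atTop (𝓝 0) := by
    have h1 : Tendsto (fun k => edist (U k) Ul) atTop (𝓝 0) := (tendsto_iff_edist_tendsto_0.1 hUl)
    refine h1.congr fun k => ?_
    have h2 : Ul = hGint.toL1 G := (Integrable.toL1_coeFn Ul hGint).symm
    rw [h2, hU, Integrable.edist_toL1_toL1]
    exact lintegral_congr fun x => edist_eq_enorm_sub _ _
  -- Step 9: `f ∘ ψ ⇀ G`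
  refine ⟨ψ, hψ, G, hGint, fun φ C hφm hφC => ?_⟩
  set C' := max C 0 with hC'
  have hC'0 : 0 ≤ C' := le_max_right _ _
  have hφC' : ∀ᵐ x ∂μ, |φ x| ≤ C' := hφC.mono fun x hx => hx.trans (le_max_left _ _)
  have hφn : ∀ᵐ x ∂μ, ‖φ x‖ ≤ C' := hφC'.mono fun x hx => by rwa [Real.norm_eq_abs]
  rw [Metric.tendsto_atTop]
  intro ε hε
  set ε₁ : ℝ := ε / (3 * (C' + 1)) with hε₁
  have hε₁0 : 0 < ε₁ := by positivity
  have hCε : C' * ε₁ < ε / 3 := by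
    rw [hε₁, mul_div_assoc', div_lt_div_iff₀ (by positivity) (by positivity)]
    nlinarith
  obtain ⟨k₀, hk₀⟩ := happrox ε₁ hε₁0
  have hUG' := (ENNReal.tendsto_atTop_zero.1 hUG) (ENNReal.ofReal ε₁) (by simpa using hε₁0)
  obtain ⟨k₁, hk₁⟩ := hUG'
  set k := max k₀ k₁ with hk
  have hA : ∀ n, ∫⁻ x, ‖f n x - g n k x‖ₑ ∂μ ≤ ENNReal.ofReal ε₁ := fun n => hk₀ k (le_max_left _ _) n
  have hB : ∫⁻ x, ‖u k x - G x‖ₑ ∂μ ≤ ENNReal.ofReal ε₁ := hk₁ k (le_max_right _ _)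
  have hwk := (hpair k φ C hφm hφC)
  rw [Metric.tendsto_atTop] at hwk
  obtain ⟨N, hN⟩ := hwk (ε / 3) (by positivity)
  refine ⟨N, fun n hn => ?_⟩
  have hsplit : ∫ x, (f ∘ ψ) n x * φ x ∂μ - ∫ x, G x * φ x ∂μ =
      ∫ x, (f (ψ n) x - g (ψ n) k x) * φ x ∂μ +
        (∫ x, g (ψ n) k x * φ x ∂μ - ∫ x, u k x * φ x ∂μ) +
        ∫ x, (u k x - G x) * φ x ∂μ := by
    have e1 : ∫ x, (f (ψ n) x - g (ψ n) k x) * φ x ∂μ =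
        ∫ x, f (ψ n) x * φ x ∂μ - ∫ x, g (ψ n) k x * φ x ∂μ := by
      rw [← integral_sub ((hint _).mul_bdd hφm hφn) ((hgint _ k).mul_bdd hφm hφn)]
      exact integral_congr_ae (ae_of_all _ fun x => by ring)
    have e2 : ∫ x, (u k x - G x) * φ x ∂μ = ∫ x, u k x * φ x ∂μ - ∫ x, G x * φ x ∂μ := by
      rw [← integral_sub ((huint k).mul_bdd hφm hφn) (hGint.mul_bdd hφm hφn)]
      exact integral_congr_ae (ae_of_all _ fun x => by ring)
    rw [e1, e2]
    simp only [Function.comp]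
    ring
  rw [Real.dist_eq, hsplit]
  have t1 : |∫ x, (f (ψ n) x - g (ψ n) k x) * φ x ∂μ| ≤ C' * ε₁ := by
    have := abs_integral_mul_le_of_lintegral_le (((hmeas _).sub (hgm _ k)).aestronglyMeasurable)
      hC'0 hφC' ENNReal.ofReal_ne_top (hA (ψ n))
    rwa [ENNReal.toReal_ofReal hε₁0.le] at this
  have t2 : |∫ x, g (ψ n) k x * φ x ∂μ - ∫ x, u k x * φ x ∂μ| < ε / 3 := by
    have := hN n hn
    rwa [Real.dist_eq] at this
  have t3 : |∫ x, (u k x - G x) * φ x ∂μ| ≤ C' * ε₁ := by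
    have := abs_integral_mul_le_of_lintegral_le ((huint k).sub hGint).1 hC'0 hφC'
      ENNReal.ofReal_ne_top hB
    rwa [ENNReal.toReal_ofReal hε₁0.le] at this
  calc |∫ x, (f (ψ n) x - g (ψ n) k x) * φ x ∂μ +
        (∫ x, g (ψ n) k x * φ x ∂μ - ∫ x, u k x * φ x ∂μ) + ∫ x, (u k x - G x) * φ x ∂μ|
      ≤ |∫ x, (f (ψ n) x - g (ψ n) k x) * φ x ∂μ| +
        |∫ x, g (ψ n) k x * φ x ∂μ - ∫ x, u k x * φ x ∂μ| + |∫ x, (u k x - G x) * φ x ∂μ| :=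
          (abs_add_le _ _).trans (add_le_add (abs_add_le _ _) le_rfl)
    _ < ε / 3 + ε / 3 + ε / 3 := by linarith
    _ = ε := by ring

/-- **The Dunford–Pettis theorem, compactness direction** — discharge of the named fact
`Literature.Analysis.FunctionSpaces.dunfordPettis_exists_subseq` (Fonseca–Leoni 2007 Thm 2.54, sufficiency): on any measure space,
a uniformly integrable (`MeasureTheory.UniformIntegrable f 1 μ`) and uniformly tight sequence of
real functions has a subsequence converging weakly in `L¹` to an integrable limit (reduction to
strongly measurable representatives and `exists_subseq_tendstoWeaklyL1_of_stronglyMeasurable`).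
[cite: FonsecaLeoni2007, Thm 2.54] -/
theorem dunfordPettis_exists_subseq_holds : dunfordPettis_exists_subseq := by
  intro α _ μ _ f hUI hUT
  set f' : ℕ → α → ℝ := fun n => (hUI.1 n).mk (f n) with hf'
  have hff' : ∀ n, f n =ᵐ[μ] f' n := fun n => (hUI.1 n).ae_eq_mk
  obtain ⟨ψ, hψ, g, hg, hw⟩ := exists_subseq_tendstoWeaklyL1_of_stronglyMeasurable
    (fun n => (hUI.1 n).stronglyMeasurable_mk) (hUI.ae_eq hff') (hUT.aeeq hff')
  refine ⟨ψ, hψ, g, hg, fun φ C hφm hφC => ?_⟩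
  refine (hw φ C hφm hφC).congr fun n => integral_congr_ae ?_
  filter_upwards [hff' (ψ n)] with x hx
  simp only [Function.comp_apply]
  rw [hx]

end DunfordPettis

end Literature.Analysis.FunctionSpaces
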